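import Summits.PneNP.PneNP.Theses.LatticeMagic

/-!
# `Target` (stmt-PneNP-10709) — negative-side lemma: half-lattice points are never in the unique-decoding regime

Crux-triage (round 1, triager 2) finding on the card `hecke-randomization-half-points`
(`Cruxes/Target/Ideas/`, sketch `Cruxes/Target/SketchIdeator1.lean`): its "sparse half-point sub-promise"
`SparseYes A c / SparseNo A c` — `GapCVP` YES/NO instances with the side conditions `2•t ∈ L(B)` and
`n^A · c · d ≤ λ₁(L(B))` — is decided by LATTICE MEMBERSHIP of the target as soon as `n^A · c > 2`
(so, at the factor `2c`, `c ≥ 1`, consumed by the card's stub `HeckeRSR`, for every `A > 0` in every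
dimension `n ≥ 2`):

* `minNorm_le_two_mul_infDist` — a half-lattice point outside the lattice is `λ₁/2`-far:
  `2•t ∈ L → t ∉ L → λ₁(L) ≤ 2·dist(t, L)` (for `v ∈ L`, `2(t − v)` is a nonzero vector of `L`);
* `targetE_mem_lattice_of_yes_halfPoint_sparse` — a YES instance (`dist ≤ d`) with `2•t ∈ L(B)`,
  `n^A·c·d ≤ λ₁` and `n^A·c > 2` has `t ∈ L(B)`;
* `targetE_not_mem_lattice_of_no` — a NO instance of `GapCVP_c` (`c ≥ 0`) has `t ∉ L(B)`.

Hence `TargetSparseAt A (2c)` fails for the trivial reason (the sub-promise is in P), `HeckeRSR A` is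
vacuous and `SparseHalfPointHard A (2c)` would give `P = NP`: the unique-decoding regime that the Hecke
equidistribution step needs contains no far-vs-close half-point instances at all.
Refuter seat refuter-cruxtri-stmt-PneNP-10709-r1-2-0, 2026-08-16.
-/

set_option linter.dupNamespace false

noncomputable section

namespace Summit.PneNP.PneNP.Theorems.Target.Negative

open Metric Literature.Algebra.EuclideanLattices

/-- A half-lattice point outside the lattice is `λ₁/2`-far: if `2•t ∈ L` and `t ∉ L` then
`λ₁(L) ≤ 2·dist(t, L)` (every `v ∈ L` gives the nonzero lattice vector `2(t - v)` of norm `2‖t - v‖`).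
[folklore] -/
theorem minNorm_le_two_mul_infDist {E : Type*} [NormedAddCommGroup E] [NormedSpace ℝ E]
    (L : Submodule ℤ E) (t : E) (h2 : (2:ℝ) • t ∈ L) (ht : t ∉ L) :
    minNorm L ≤ 2 * infDist t (L : Set E) := by
  by_contra hlt
  push Not at hlt
  have hne : (L : Set E).Nonempty := ⟨0, L.zero_mem⟩
  have hlt' : infDist t (L : Set E) < minNorm L / 2 := by linarith
  obtain ⟨y, hy, hdist⟩ := (Metric.infDist_lt_iff hne).1 hlt'
  have hy2 : (2:ℝ) • y ∈ L := by
    rw [two_smul]; exact L.add_mem hy hy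
  have hmem : (2:ℝ) • (t - y) ∈ L := by
    rw [smul_sub]; exact L.sub_mem h2 hy2
  have hne0 : (2:ℝ) • (t - y) ≠ 0 := by
    intro h0
    rcases smul_eq_zero.1 h0 with h | h
    · norm_num at h
    · exact ht (by rw [sub_eq_zero] at h; rw [h]; exact hy)
  have hle : minNorm L ≤ ‖(2:ℝ) • (t - y)‖ :=
    csInf_le ⟨0, by rintro _ ⟨x, -, rfl⟩; exact norm_nonneg x⟩ ⟨_, ⟨hmem, hne0⟩, rfl⟩
  rw [norm_smul, Real.norm_two, ← dist_eq_norm] at hle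
  linarith

/-- A YES instance of `GapCVP` (`dist(t, L(B)) ≤ d`) whose target is a half-lattice point (`2•t ∈ L(B)`)
and whose lattice is sparse at scale `d` (`n^A · c · d ≤ λ₁(L(B))` with `n^A · c > 2`) has its target IN
the lattice — the "sparse half-point" YES side is lattice membership. [folklore] -/
theorem targetE_mem_lattice_of_yes_halfPoint_sparse (γ : ℕ → ℝ) (A c : ℝ) (q : GapCVPInstance)
    (hyes : q ∈ GapCVP.yes γ) (h2 : (2 : ℝ) • q.1.targetE ∈ q.1.I.lattice)
    (hmin : (q.1.I.n : ℝ) ^ A * c * (q.2 : ℝ) ≤ minNorm q.1.I.lattice)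
    (hgap : 2 < (q.1.I.n : ℝ) ^ A * c) : q.1.targetE ∈ q.1.I.lattice := by
  obtain ⟨_, hd, hdist⟩ := hyes
  by_contra ht
  have key := minNorm_le_two_mul_infDist q.1.I.lattice q.1.targetE h2 ht
  have hd' : (0:ℝ) < (q.2 : ℝ) := by exact_mod_cast hd
  have h1 : (q.1.I.n : ℝ) ^ A * c * (q.2 : ℝ) ≤ 2 * (q.2 : ℝ) := by linarith
  have h2' : (q.1.I.n : ℝ) ^ A * c ≤ 2 := le_of_mul_le_mul_right h1 hd'
  linarith

/-- A NO instance of `GapCVP_c` (`c · d < dist(t, L(B))`, `c ≥ 0`) has its target OUTSIDE the lattice.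
[folklore] -/
theorem targetE_not_mem_lattice_of_no (c : ℝ) (hc : 0 ≤ c) (q : GapCVPInstance)
    (hno : q ∈ GapCVP.no (fun _ => c)) : q.1.targetE ∉ q.1.I.lattice := by
  obtain ⟨_, hd, hdist⟩ := hno
  intro ht
  have h0 : infDist q.1.targetE (q.1.I.lattice : Set _) = 0 := Metric.infDist_zero_of_mem ht
  rw [h0] at hdist
  have hd' : (0:ℝ) < (q.2 : ℝ) := by exact_mod_cast hd
  have : 0 ≤ c * (q.2 : ℝ) := mul_nonneg hc hd'.le
  linarith

/-- The regime used by the card's `HeckeRSR` (factor `2c`, `c ≥ 1`; sparsity exponent `A > 0`): in every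
dimension `n ≥ 2` the gap condition `n^A · (2c) > 2` holds, so the two lemmas above decide the sparse
half-point sub-promise by lattice membership. [folklore] -/
theorem two_lt_rpow_mul_two_mul (A c : ℝ) (hA : 0 < A) (hc : 1 ≤ c) (n : ℕ) (hn : 2 ≤ n) :
    2 < (n : ℝ) ^ A * (2 * c) := by
  have hn' : (2:ℝ) ≤ (n : ℝ) := by exact_mod_cast hn
  have hpow : (1:ℝ) < (n : ℝ) ^ A := Real.one_lt_rpow (by linarith) hA
  nlinarith

end Summit.PneNP.PneNP.Theorems.Target.Negative

end
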